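import Summits.QuantumFields.BalabanUV.Beta.GAN24.DerivativeRateTransferJensenMassFreePolarNear
import Mathlib.Analysis.Normed.Algebra.MatrixExponential
import Mathlib.Analysis.SpecialFunctions.Exponential
import Mathlib.Analysis.Complex.Exponential

/-!
# `BalabanUV.Beta.GAN24.DerivativeRateTransferJensenMassFreeExpTaylor` — binder row G-an2-4 ∕ (CONV-C), route R6 «VALUES, NOT DERIVATIVES», PART 67:
# THE EXP-MEAN-LOG LINK AGAINST THE MEAN TRANSPORT TO THIRD ORDER — for skew `A_x` with `‖A_x‖ ≤ s ≤ 1` (Frobenius), weights `q ≥ 0`, `Σq = 1`,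
# `M := Σ_x q_x·exp(A_x)` (the mean transport) and `Ā := Σ_x q_x·A_x` (the (1.28)-type Lie-algebra mean), the matrix `E := M·exp(Ā)ᵀ − 1` satisfies
#   `‖E‖ ≤ s² + (5∕2)·s³`   and   `‖E − Eᵀ‖ ≤ 5·s³`
# — its symmetric second-order part `½(S₂ − Ā²)` drops out of the skew part, which is THIRD order (unit b2b-balaban-gan24-p3, gen 45; v1)

NOT IN PRINT; OUR PROOF (for the ROUTE; [folklore] the exponential series in a complete normed algebra (Mathlib `NormedSpace.exp`, `Real.exp_bound`)
and bookkeeping in Mathlib's scoped Frobenius norm).  HONEST FRAMING (cell contract, verbatim): «discharging `BetaPertH` makes Bałaban's UV stability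
UNCONDITIONAL — a real constructive-QFT result; it is NOT the continuum limit and NOT the Clay problem.»  HONEST DEPENDENCY (verbatim): «continuum YM on
T⁴ ⇐ BetaPertH ∧ nine spine estimates (0/9 proved); BetaPertH ⇐ (D1) ∧ (D4) ∧ CAP+tail; G-an2-4 gates asym, D1 and NE2/3/4.»

WHY THIS FILE.  PART 66 (`DerivativeRateTransferJensenMassFreePolarNear`) bounds the distance between the polar link `R′` of `M` and any orthogonal `R_B`
by `½‖E − Eᵀ‖ + 4‖E‖²`, `E = M·R_Bᵀ − 1`.  For Bałaban–Jaffe's convention (1.28) [Erice 1985 p. 221] — average the LOGARITHMS of the contour variables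
relative to a base contour and exponentiate — the coarse link is `R_B = exp(Ā)·τ₀` with `Ā = Σ_x q_x A_x` when the transports are `τ_x = exp(A_x)·τ₀`
(Lie-algebra data `A_x`, skew, of size `s`; print's small-field regime (1.31)).  THIS FILE computes `E` for that link (base `τ₀ = 1`; PART 68 restores the
base): with `exp(A) = 1 + A + ½A² + ρ(A)`, `‖ρ(A)‖ ≤ (2∕9)‖A‖³` (`‖A‖ ≤ 1`), one gets `M = 1 + Ā + H + ρ`, `exp(Ā)ᵀ = exp(−Ā) = 1 − Ā + G + ρ′` with
`H = ½S₂`, `S₂ = Σ_x q_xA_x²`, `G = ½Ā²`, `‖ρ‖, ‖ρ′‖ ≤ (2∕9)s³`, hence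
  `E = (H + G − Ā²) + (ĀG − HĀ) + R`,  `R = ρ + ρ′ + Āρ′ + HG + Hρ′ − ρĀ + ρG + ρρ′`,
where `H + G − Ā² = H − G` is SYMMETRIC of norm `≤ s²`, `‖ĀG − HĀ‖ ≤ s³`, `‖R‖ ≤ (457∕324)s³ ≤ (3∕2)s³`; so `‖E‖ ≤ s² + (5∕2)s³` and, the symmetric part
cancelling, `‖E − Eᵀ‖ ≤ 2s³ + 3s³ = 5s³`.

WHAT THIS FILE PROVES (0 sorry, 0 `def`, nothing cited):
* §1 (any complete normed `ℝ`-algebra) **`norm_exp_sub_sum_le`** (`‖exp x − Σ_{m<n} x^m∕m!‖ ≤ ‖x‖ⁿ·(n+1)∕(n!·n)` for `‖x‖ ≤ 1`, `0 < n`),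
  `norm_exp_sub_one_le` (`≤ 2‖x‖`), **`norm_exp_sub_taylor₃_le`** (`‖exp x − (1 + x + ½x²)‖ ≤ (2∕9)‖x‖³`).
* §2 (real matrices, Frobenius) `transpose_exp_of_skew` (`exp(A)ᵀ = exp(−A)`), **`orthogonal_exp_of_skew`** (`exp(A)ᵀexp(A) = 1`), `exp_mul_transpose_exp_of_skew`,
  `transpose_sq_of_skew`, weighted-mean bookkeeping `norm_wsum_le`, `wsum_skew`, `norm_wmean_le`, `norm_wsq_le`, `norm_wexp_sub_le`.
* §3 **`norm_meanDefect_le`** (`‖E‖ ≤ s² + (5∕2)s³`) and **`norm_meanDefect_skew_le`** (`‖E − Eᵀ‖ ≤ 5s³`) for `E = (Σ_x q_x•exp A_x)·exp(Σ_x q_x•A_x)ᵀ − 1`.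
WHAT IT DOES NOT DO: produce the `A_x` from group-valued transports (a matrix logarithm — not in Mathlib; `A_x` is DATA), compare with the polar link
(PART 68 with PART 66), instantiate anything of Bałaban's, or claim (CONS) ∕ exact (STAB).  SUPPLIER work on route R6 (rank 2, REDUCTION, no seat); no
consumer of record; NEVER «G-an2-4 closed»; NOT (CONV-C), NOT D1, NOT `BetaPertH`, NOT continuum, NOT Clay.  Records: `HOME/b2b-balaban-gan24-p3/WOODBURY-FIBRE.md` v14.5. -/

noncomputable section

open scoped Matrix Matrix.Norms.Frobenius
open NormedSpace Finset Matrix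

namespace Summit.QuantumFields.BalabanUV.Beta.GAN24.DerivativeRateTransferJensenMassFreeExpTaylor

open Summit.QuantumFields.BalabanUV.Beta.GAN24.DerivativeRateTransferJensenMassFreePolarNear

/-! ## §1 Taylor remainders of `exp` in a complete normed real algebra -/

section Banach

variable {𝔸 : Type*} [NormedRing 𝔸] [NormedAlgebra ℝ 𝔸] [CompleteSpace 𝔸]

/-- **`norm_exp_sub_sum_le`** [folklore; our proof]: in a complete normed `ℝ`-algebra, for `‖x‖ ≤ 1` and `0 < n`,
`‖exp x − Σ_{m<n} (m!)⁻¹•x^m‖ ≤ ‖x‖ⁿ·(n+1)∕(n!·n)` (the tail is majorised termwise by the real tail, bounded by `Real.exp_bound`). -/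
theorem norm_exp_sub_sum_le (x : 𝔸) (hx : ‖x‖ ≤ 1) {n : ℕ} (hn : 0 < n) :
    ‖exp x - ∑ m ∈ range n, ((m.factorial : ℝ)⁻¹) • x ^ m‖ ≤ ‖x‖ ^ n * ((n.succ : ℝ) / (n.factorial * n)) := by
  have hF : HasSum (fun m => ((m.factorial : ℝ)⁻¹) • x ^ m) (exp x) := NormedSpace.exp_series_hasSum_exp' (𝕂 := ℝ) x
  have hFt : HasSum (fun m => (((m + n).factorial : ℝ)⁻¹) • x ^ (m + n)) (exp x - ∑ m ∈ range n, ((m.factorial : ℝ)⁻¹) • x ^ m) :=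
    (hasSum_nat_add_iff' n).mpr hF
  have hG : HasSum (fun m => ‖x‖ ^ m / m.factorial) (Real.exp ‖x‖) := by
    rw [congrFun Real.exp_eq_exp_ℝ ‖x‖]
    exact NormedSpace.expSeries_div_hasSum_exp ‖x‖
  have hGt : HasSum (fun m => ‖x‖ ^ (m + n) / (m + n).factorial) (Real.exp ‖x‖ - ∑ m ∈ range n, ‖x‖ ^ m / m.factorial) :=
    (hasSum_nat_add_iff' n).mpr hG
  have hle : ∀ m, ‖(((m + n).factorial : ℝ)⁻¹) • x ^ (m + n)‖ ≤ ‖x‖ ^ (m + n) / (m + n).factorial := by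
    intro m
    rw [norm_smul, Real.norm_eq_abs, abs_of_pos (by positivity), div_eq_inv_mul]
    exact mul_le_mul_of_nonneg_left (norm_pow_le' x (by omega)) (by positivity)
  have h1 := hFt.norm_le_of_bounded hGt hle
  have h2 := Real.exp_bound (x := ‖x‖) (by rw [abs_of_nonneg (norm_nonneg x)]; exact hx) hn
  rw [abs_of_nonneg (norm_nonneg x)] at h2
  exact h1.trans ((le_abs_self _).trans h2)

/-- `‖exp x − 1‖ ≤ 2‖x‖` for `‖x‖ ≤ 1`. [folklore] -/
theorem norm_exp_sub_one_le (x : 𝔸) (hx : ‖x‖ ≤ 1) : ‖exp x - 1‖ ≤ 2 * ‖x‖ := by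
  have h := norm_exp_sub_sum_le x hx one_pos
  simp only [range_one, sum_singleton, Nat.factorial_zero, Nat.cast_one, inv_one, pow_zero, one_smul, pow_one,
    Nat.factorial_one, mul_one, Nat.succ_eq_add_one] at h
  norm_num at h
  linarith

/-- **`norm_exp_sub_taylor₃_le`** [folklore; our proof]: `‖exp x − (1 + x + ½•x²)‖ ≤ (2∕9)‖x‖³` for `‖x‖ ≤ 1`. -/
theorem norm_exp_sub_taylor₃_le (x : 𝔸) (hx : ‖x‖ ≤ 1) : ‖exp x - (1 + x + (2 : ℝ)⁻¹ • (x * x))‖ ≤ 2 / 9 * ‖x‖ ^ 3 := by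
  have h := norm_exp_sub_sum_le x hx (n := 3) (by norm_num)
  have e : ∑ m ∈ range 3, ((m.factorial : ℝ)⁻¹) • x ^ m = 1 + x + (2 : ℝ)⁻¹ • (x * x) := by
    simp only [Finset.sum_range_succ, Finset.sum_range_zero, Nat.factorial, Nat.succ_eq_add_one, zero_add, mul_one, Nat.cast_one,
      inv_one, pow_zero, one_smul, pow_one, Nat.reduceAdd, Nat.cast_ofNat, pow_two]
  rw [e] at h
  refine h.trans (le_of_eq ?_)
  simp only [Nat.factorial, Nat.succ_eq_add_one, Nat.reduceAdd, Nat.reduceMul, Nat.cast_ofNat]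
  ring

end Banach

/-! ## §2 Real matrices: skew exponentials are orthogonal; weighted means -/

section Matrices

variable {o ν : Type*} [Fintype o] [DecidableEq o] [Fintype ν]

omit [Fintype ν] in
/-- `exp(A)ᵀ = exp(−A)` for skew `A`. [folklore] -/
theorem transpose_exp_of_skew {A : Matrix o o ℝ} (hA : Aᵀ = -A) : (exp A)ᵀ = exp (-A) := by
  rw [← Matrix.exp_transpose, hA]

omit [Fintype ν] in
/-- **`orthogonal_exp_of_skew`**: `exp(A)ᵀ·exp(A) = 1` for skew `A`. [folklore] -/
theorem orthogonal_exp_of_skew {A : Matrix o o ℝ} (hA : Aᵀ = -A) : (exp A)ᵀ * exp A = 1 := by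
  rw [transpose_exp_of_skew hA, ← Matrix.exp_add_of_commute (-A) A (Commute.neg_left (Commute.refl A)), neg_add_cancel, exp_zero]

omit [Fintype ν] in
/-- `exp(A)·exp(A)ᵀ = 1` for skew `A`. [folklore] -/
theorem exp_mul_transpose_exp_of_skew {A : Matrix o o ℝ} (hA : Aᵀ = -A) : exp A * (exp A)ᵀ = 1 :=
  mul_eq_one_comm.mp (orthogonal_exp_of_skew hA)

omit [Fintype o] [DecidableEq o] [Fintype ν] in
/-- `(A·A)ᵀ = A·A` for skew `A`. [folklore] -/
theorem transpose_sq_of_skew {A : Matrix o o ℝ} [Fintype o] (hA : Aᵀ = -A) : (A * A)ᵀ = A * A := by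
  rw [transpose_mul, hA, neg_mul_neg]

/-- `‖Σ_x q_x•B_x‖ ≤ Σ_x q_x‖B_x‖` for `q ≥ 0`. [folklore] -/
theorem norm_wsum_le {q : ν → ℝ} (hq : ∀ x, 0 ≤ q x) (B : ν → Matrix o o ℝ) : ‖∑ x, q x • B x‖ ≤ ∑ x, q x * ‖B x‖ := by
  refine (norm_sum_le _ _).trans (Finset.sum_le_sum fun x _ => ?_)
  rw [norm_smul, Real.norm_eq_abs, abs_of_nonneg (hq x)]

/-- `Σ_x q_x·c_x ≤ c` when `c_x ≤ c`, `q ≥ 0`, `Σq = 1`. [folklore] -/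
theorem wsum_le_of_le {q : ν → ℝ} (hq : ∀ x, 0 ≤ q x) (hq1 : ∑ x, q x = 1) {c : ν → ℝ} {b : ℝ} (hc : ∀ x, c x ≤ b) :
    ∑ x, q x * c x ≤ b := by
  calc ∑ x, q x * c x ≤ ∑ x, q x * b := Finset.sum_le_sum fun x _ => mul_le_mul_of_nonneg_left (hc x) (hq x)
    _ = b := by rw [← Finset.sum_mul, hq1, one_mul]

omit [Fintype o] [DecidableEq o] in
/-- the mean of skew matrices is skew. [folklore] -/
theorem wsum_skew {q : ν → ℝ} {A : ν → Matrix o o ℝ} (hA : ∀ x, (A x)ᵀ = -A x) : (∑ x, q x • A x)ᵀ = -∑ x, q x • A x := by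
  rw [transpose_sum, ← Finset.sum_neg_distrib]
  exact Finset.sum_congr rfl fun x _ => by rw [transpose_smul, hA x, smul_neg]

/-- `‖Ā‖ ≤ s`. [folklore] -/
theorem norm_wmean_le {q : ν → ℝ} (hq : ∀ x, 0 ≤ q x) (hq1 : ∑ x, q x = 1) {A : ν → Matrix o o ℝ} {s : ℝ} (hs : ∀ x, ‖A x‖ ≤ s) :
    ‖∑ x, q x • A x‖ ≤ s :=
  (norm_wsum_le hq A).trans (wsum_le_of_le hq hq1 hs)

/-- `‖S₂‖ = ‖Σ_x q_x•A_x²‖ ≤ s²`. [folklore] -/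
theorem norm_wsq_le {q : ν → ℝ} (hq : ∀ x, 0 ≤ q x) (hq1 : ∑ x, q x = 1) {A : ν → Matrix o o ℝ} {s : ℝ} (hs : ∀ x, ‖A x‖ ≤ s) :
    ‖∑ x, q x • (A x * A x)‖ ≤ s ^ 2 := by
  refine (norm_wsum_le hq _).trans (wsum_le_of_le hq hq1 fun x => ?_)
  rw [sq]
  exact (norm_mul_le _ _).trans (mul_le_mul (hs x) (hs x) (norm_nonneg _) ((norm_nonneg _).trans (hs x)))

/-- the mean transport against its second-order Taylor polynomial: `‖Σ_x q_x•exp A_x − (1 + Ā + ½S₂)‖ ≤ (2∕9)s³` (`‖A_x‖ ≤ s ≤ 1`). [our proof] -/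
theorem norm_wexp_sub_le {q : ν → ℝ} (hq : ∀ x, 0 ≤ q x) (hq1 : ∑ x, q x = 1) {A : ν → Matrix o o ℝ} {s : ℝ} (hs : ∀ x, ‖A x‖ ≤ s)
    (hs1 : s ≤ 1) :
    ‖∑ x, q x • exp (A x) - (1 + ∑ x, q x • A x + (2 : ℝ)⁻¹ • ∑ x, q x • (A x * A x))‖ ≤ 2 / 9 * s ^ 3 := by
  have e : ∑ x, q x • exp (A x) - (1 + ∑ x, q x • A x + (2 : ℝ)⁻¹ • ∑ x, q x • (A x * A x)) =
      ∑ x, q x • (exp (A x) - (1 + A x + (2 : ℝ)⁻¹ • (A x * A x))) := by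
    have h1 : ∑ x, q x • (1 : Matrix o o ℝ) = 1 := by rw [← Finset.sum_smul, hq1, one_smul]
    have h2 : (2 : ℝ)⁻¹ • ∑ x, q x • (A x * A x) = ∑ x, q x • ((2 : ℝ)⁻¹ • (A x * A x)) := by
      rw [Finset.smul_sum]; exact Finset.sum_congr rfl fun x _ => smul_comm _ _ _
    simp only [smul_sub, smul_add, Finset.sum_sub_distrib, Finset.sum_add_distrib, h1, ← h2]
  rw [e]
  refine (norm_wsum_le hq _).trans (wsum_le_of_le hq hq1 fun x => ?_)
  have hx1 : ‖A x‖ ≤ 1 := (hs x).trans hs1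
  refine (norm_exp_sub_taylor₃_le (A x) hx1).trans ?_
  exact mul_le_mul_of_nonneg_left (pow_le_pow_left₀ (norm_nonneg _) (hs x) 3) (by norm_num)

/-! ## §3 The defect `E = M·exp(Ā)ᵀ − 1` of the exp-mean-log link -/

/-- the expansion identity: with `M = 1 + Ā + H + ρ` and `N = 1 − Ā + G + ρ′`,
`M·N − 1 = (H + G − Ā·Ā) + (Ā·G − H·Ā) + (ρ + ρ′ + Ā·ρ′ + H·G + H·ρ′ − ρ·Ā + ρ·G + ρ·ρ′)`. [folklore] -/
theorem mul_sub_one_expand (Ab H G ρ ρ' M N : Matrix o o ℝ) (hM : M = 1 + Ab + H + ρ) (hN : N = 1 - Ab + G + ρ') :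
    M * N - 1 = (H + G - Ab * Ab) + (Ab * G - H * Ab) + (ρ + ρ' + Ab * ρ' + H * G + H * ρ' - ρ * Ab + ρ * G + ρ * ρ') := by
  rw [hM, hN]
  noncomm_ring

/-- **`norm_meanDefect_le` — THE DEFECT OF THE EXP-MEAN-LOG LINK IS SECOND ORDER** [our proof]: skew `A_x` with `‖A_x‖ ≤ s ≤ 1`, weights `q ≥ 0` with
`Σq = 1` ⟹ `‖(Σ_x q_x•exp A_x)·exp(Σ_x q_x•A_x)ᵀ − 1‖ ≤ s² + (5∕2)s³`. -/
theorem norm_meanDefect_le {q : ν → ℝ} (hq : ∀ x, 0 ≤ q x) (hq1 : ∑ x, q x = 1) {A : ν → Matrix o o ℝ} (hA : ∀ x, (A x)ᵀ = -A x)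
    {s : ℝ} (hs : ∀ x, ‖A x‖ ≤ s) (hs1 : s ≤ 1) :
    ‖(∑ x, q x • exp (A x)) * (exp (∑ x, q x • A x))ᵀ - 1‖ ≤ s ^ 2 + 5 / 2 * s ^ 3 := by
  have hs0 : 0 ≤ s := by
    obtain ⟨x, -, hx⟩ : ∃ x ∈ (Finset.univ : Finset ν), q x ≠ 0 :=
      Finset.exists_ne_zero_of_sum_ne_zero (by rw [hq1]; exact one_ne_zero)
    exact (norm_nonneg _).trans (hs x)
  set Ab : Matrix o o ℝ := ∑ x, q x • A x with hAb
  set H : Matrix o o ℝ := (2 : ℝ)⁻¹ • ∑ x, q x • (A x * A x) with hH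
  set G : Matrix o o ℝ := (2 : ℝ)⁻¹ • (Ab * Ab) with hG
  set ρ : Matrix o o ℝ := ∑ x, q x • exp (A x) - (1 + Ab + H) with hρ
  set ρ' : Matrix o o ℝ := exp (-Ab) - (1 + -Ab + (2 : ℝ)⁻¹ • (-Ab * -Ab)) with hρ'
  have hAbt : Abᵀ = -Ab := wsum_skew hA
  have hAbn : ‖Ab‖ ≤ s := norm_wmean_le hq hq1 hs
  have hHn : ‖H‖ ≤ 2⁻¹ * s ^ 2 := by
    rw [hH, norm_smul, Real.norm_eq_abs, abs_of_pos (by norm_num)]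
    exact mul_le_mul_of_nonneg_left (norm_wsq_le hq hq1 hs) (by norm_num)
  have hGn : ‖G‖ ≤ 2⁻¹ * s ^ 2 := by
    rw [hG, norm_smul, Real.norm_eq_abs, abs_of_pos (by norm_num), sq]
    exact mul_le_mul_of_nonneg_left ((norm_mul_le _ _).trans (mul_le_mul hAbn hAbn (norm_nonneg _) hs0)) (by norm_num)
  have hρn : ‖ρ‖ ≤ 2 / 9 * s ^ 3 := by
    have h := norm_wexp_sub_le hq hq1 hs hs1
    rwa [← hAb, ← hH] at h
  have hρ'n : ‖ρ'‖ ≤ 2 / 9 * s ^ 3 := by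
    have h1 : ‖-Ab‖ ≤ 1 := by rw [norm_neg]; exact hAbn.trans hs1
    refine (norm_exp_sub_taylor₃_le (-Ab) h1).trans ?_
    rw [norm_neg]
    exact mul_le_mul_of_nonneg_left (pow_le_pow_left₀ (norm_nonneg _) hAbn 3) (by norm_num)
  have hM : ∑ x, q x • exp (A x) = 1 + Ab + H + ρ := by rw [hρ]; abel
  have hN : (exp Ab)ᵀ = 1 - Ab + G + ρ' := by
    rw [transpose_exp_of_skew hAbt, hρ', hG, neg_mul_neg]; abel
  rw [mul_sub_one_expand Ab H G ρ ρ' _ _ hM hN]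
  -- `H + G − Ā² = H − G`
  have e1 : H + G - Ab * Ab = H - G := by
    have : Ab * Ab = (2 : ℝ) • G := by rw [hG, smul_smul, mul_inv_cancel₀ (two_ne_zero), one_smul]
    rw [this, two_smul]; abel
  rw [e1]
  have n1 : ‖H - G‖ ≤ s ^ 2 := (norm_sub_le _ _).trans (by linarith)
  have n2 : ‖Ab * G - H * Ab‖ ≤ s ^ 3 := by
    refine (norm_sub_le _ _).trans ?_
    have h1 : ‖Ab * G‖ ≤ s * (2⁻¹ * s ^ 2) := (norm_mul_le _ _).trans (mul_le_mul hAbn hGn (norm_nonneg _) hs0)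
    have h2 : ‖H * Ab‖ ≤ 2⁻¹ * s ^ 2 * s := (norm_mul_le _ _).trans (mul_le_mul hHn hAbn (norm_nonneg _) (by positivity))
    nlinarith
  have n3 : ‖ρ + ρ' + Ab * ρ' + H * G + H * ρ' - ρ * Ab + ρ * G + ρ * ρ'‖ ≤ 3 / 2 * s ^ 3 := by
    have h3 : ‖Ab * ρ'‖ ≤ s * (2 / 9 * s ^ 3) := (norm_mul_le _ _).trans (mul_le_mul hAbn hρ'n (norm_nonneg _) hs0)
    have h4 : ‖H * G‖ ≤ 2⁻¹ * s ^ 2 * (2⁻¹ * s ^ 2) := (norm_mul_le _ _).trans (mul_le_mul hHn hGn (norm_nonneg _) (by positivity))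
    have h5 : ‖H * ρ'‖ ≤ 2⁻¹ * s ^ 2 * (2 / 9 * s ^ 3) := (norm_mul_le _ _).trans (mul_le_mul hHn hρ'n (norm_nonneg _) (by positivity))
    have h6 : ‖ρ * Ab‖ ≤ 2 / 9 * s ^ 3 * s := (norm_mul_le _ _).trans (mul_le_mul hρn hAbn (norm_nonneg _) (by positivity))
    have h7 : ‖ρ * G‖ ≤ 2 / 9 * s ^ 3 * (2⁻¹ * s ^ 2) := (norm_mul_le _ _).trans (mul_le_mul hρn hGn (norm_nonneg _) (by positivity))
    have h8 : ‖ρ * ρ'‖ ≤ 2 / 9 * s ^ 3 * (2 / 9 * s ^ 3) := (norm_mul_le _ _).trans (mul_le_mul hρn hρ'n (norm_nonneg _) (by positivity))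
    have t1 := norm_add_le ρ ρ'
    have t2 := norm_add_le (ρ + ρ') (Ab * ρ')
    have t3 := norm_add_le (ρ + ρ' + Ab * ρ') (H * G)
    have t4 := norm_add_le (ρ + ρ' + Ab * ρ' + H * G) (H * ρ')
    have t5 := norm_sub_le (ρ + ρ' + Ab * ρ' + H * G + H * ρ') (ρ * Ab)
    have t6 := norm_add_le (ρ + ρ' + Ab * ρ' + H * G + H * ρ' - ρ * Ab) (ρ * G)
    have t7 := norm_add_le (ρ + ρ' + Ab * ρ' + H * G + H * ρ' - ρ * Ab + ρ * G) (ρ * ρ')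
    have p4 : s ^ 4 ≤ s ^ 3 := pow_le_pow_of_le_one hs0 hs1 (by norm_num)
    have p5 : s ^ 5 ≤ s ^ 3 := pow_le_pow_of_le_one hs0 hs1 (by norm_num)
    have p6 : s ^ 6 ≤ s ^ 3 := pow_le_pow_of_le_one hs0 hs1 (by norm_num)
    nlinarith
  have t8 := norm_add_le (H - G) (Ab * G - H * Ab)
  have t9 := norm_add_le (H - G + (Ab * G - H * Ab)) (ρ + ρ' + Ab * ρ' + H * G + H * ρ' - ρ * Ab + ρ * G + ρ * ρ')
  linarith

/-- **`norm_meanDefect_skew_le` — ITS SKEW PART IS THIRD ORDER** [our proof]: under the same hypotheses, with `E = (Σ_x q_x•exp A_x)·exp(Σ_x q_x•A_x)ᵀ − 1`: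
`‖E − Eᵀ‖ ≤ 5s³` (the symmetric second-order part `H − G = ½(S₂ − Ā²)` cancels). -/
theorem norm_meanDefect_skew_le {q : ν → ℝ} (hq : ∀ x, 0 ≤ q x) (hq1 : ∑ x, q x = 1) {A : ν → Matrix o o ℝ} (hA : ∀ x, (A x)ᵀ = -A x)
    {s : ℝ} (hs : ∀ x, ‖A x‖ ≤ s) (hs1 : s ≤ 1) :
    ‖((∑ x, q x • exp (A x)) * (exp (∑ x, q x • A x))ᵀ - 1) - ((∑ x, q x • exp (A x)) * (exp (∑ x, q x • A x))ᵀ - 1)ᵀ‖ ≤ 5 * s ^ 3 := by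
  have hs0 : 0 ≤ s := by
    obtain ⟨x, -, hx⟩ : ∃ x ∈ (Finset.univ : Finset ν), q x ≠ 0 :=
      Finset.exists_ne_zero_of_sum_ne_zero (by rw [hq1]; exact one_ne_zero)
    exact (norm_nonneg _).trans (hs x)
  set Ab : Matrix o o ℝ := ∑ x, q x • A x with hAb
  set H : Matrix o o ℝ := (2 : ℝ)⁻¹ • ∑ x, q x • (A x * A x) with hH
  set G : Matrix o o ℝ := (2 : ℝ)⁻¹ • (Ab * Ab) with hG
  set ρ : Matrix o o ℝ := ∑ x, q x • exp (A x) - (1 + Ab + H) with hρ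
  set ρ' : Matrix o o ℝ := exp (-Ab) - (1 + -Ab + (2 : ℝ)⁻¹ • (-Ab * -Ab)) with hρ'
  have hAbt : Abᵀ = -Ab := wsum_skew hA
  have hAbn : ‖Ab‖ ≤ s := norm_wmean_le hq hq1 hs
  have hHn : ‖H‖ ≤ 2⁻¹ * s ^ 2 := by
    rw [hH, norm_smul, Real.norm_eq_abs, abs_of_pos (by norm_num)]
    exact mul_le_mul_of_nonneg_left (norm_wsq_le hq hq1 hs) (by norm_num)
  have hGn : ‖G‖ ≤ 2⁻¹ * s ^ 2 := by
    rw [hG, norm_smul, Real.norm_eq_abs, abs_of_pos (by norm_num), sq]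
    exact mul_le_mul_of_nonneg_left ((norm_mul_le _ _).trans (mul_le_mul hAbn hAbn (norm_nonneg _) hs0)) (by norm_num)
  have hρn : ‖ρ‖ ≤ 2 / 9 * s ^ 3 := by
    have h := norm_wexp_sub_le hq hq1 hs hs1
    rwa [← hAb, ← hH] at h
  have hρ'n : ‖ρ'‖ ≤ 2 / 9 * s ^ 3 := by
    have h1 : ‖-Ab‖ ≤ 1 := by rw [norm_neg]; exact hAbn.trans hs1
    refine (norm_exp_sub_taylor₃_le (-Ab) h1).trans ?_
    rw [norm_neg]
    exact mul_le_mul_of_nonneg_left (pow_le_pow_left₀ (norm_nonneg _) hAbn 3) (by norm_num)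
  have hM : ∑ x, q x • exp (A x) = 1 + Ab + H + ρ := by rw [hρ]; abel
  have hN : (exp Ab)ᵀ = 1 - Ab + G + ρ' := by
    rw [transpose_exp_of_skew hAbt, hρ', hG, neg_mul_neg]; abel
  rw [mul_sub_one_expand Ab H G ρ ρ' _ _ hM hN]
  -- the symmetric part `H + G − Ā² = H − G` cancels
  have hHt : Hᵀ = H := by
    rw [hH, transpose_smul, transpose_sum]
    congr 1
    exact Finset.sum_congr rfl fun x _ => by rw [transpose_smul, transpose_sq_of_skew (hA x)]
  have hGt : Gᵀ = G := by rw [hG, transpose_smul, transpose_sq_of_skew hAbt]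
  have hSt : (H + G - Ab * Ab)ᵀ = H + G - Ab * Ab := by rw [transpose_sub, transpose_add, hHt, hGt, transpose_sq_of_skew hAbt]
  set K : Matrix o o ℝ := Ab * G - H * Ab with hK
  set R : Matrix o o ℝ := ρ + ρ' + Ab * ρ' + H * G + H * ρ' - ρ * Ab + ρ * G + ρ * ρ' with hR
  have e : (H + G - Ab * Ab) + K + R - ((H + G - Ab * Ab) + K + R)ᵀ = (K - Kᵀ) + (R - Rᵀ) := by
    rw [transpose_add, transpose_add, hSt]; abel
  rw [e]
  have n2 : ‖K‖ ≤ s ^ 3 := by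
    refine (norm_sub_le _ _).trans ?_
    have h1 : ‖Ab * G‖ ≤ s * (2⁻¹ * s ^ 2) := (norm_mul_le _ _).trans (mul_le_mul hAbn hGn (norm_nonneg _) hs0)
    have h2 : ‖H * Ab‖ ≤ 2⁻¹ * s ^ 2 * s := (norm_mul_le _ _).trans (mul_le_mul hHn hAbn (norm_nonneg _) (by positivity))
    nlinarith
  have n3 : ‖R‖ ≤ 3 / 2 * s ^ 3 := by
    have h3 : ‖Ab * ρ'‖ ≤ s * (2 / 9 * s ^ 3) := (norm_mul_le _ _).trans (mul_le_mul hAbn hρ'n (norm_nonneg _) hs0)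
    have h4 : ‖H * G‖ ≤ 2⁻¹ * s ^ 2 * (2⁻¹ * s ^ 2) := (norm_mul_le _ _).trans (mul_le_mul hHn hGn (norm_nonneg _) (by positivity))
    have h5 : ‖H * ρ'‖ ≤ 2⁻¹ * s ^ 2 * (2 / 9 * s ^ 3) := (norm_mul_le _ _).trans (mul_le_mul hHn hρ'n (norm_nonneg _) (by positivity))
    have h6 : ‖ρ * Ab‖ ≤ 2 / 9 * s ^ 3 * s := (norm_mul_le _ _).trans (mul_le_mul hρn hAbn (norm_nonneg _) (by positivity))
    have h7 : ‖ρ * G‖ ≤ 2 / 9 * s ^ 3 * (2⁻¹ * s ^ 2) := (norm_mul_le _ _).trans (mul_le_mul hρn hGn (norm_nonneg _) (by positivity))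
    have h8 : ‖ρ * ρ'‖ ≤ 2 / 9 * s ^ 3 * (2 / 9 * s ^ 3) := (norm_mul_le _ _).trans (mul_le_mul hρn hρ'n (norm_nonneg _) (by positivity))
    have t1 := norm_add_le ρ ρ'
    have t2 := norm_add_le (ρ + ρ') (Ab * ρ')
    have t3 := norm_add_le (ρ + ρ' + Ab * ρ') (H * G)
    have t4 := norm_add_le (ρ + ρ' + Ab * ρ' + H * G) (H * ρ')
    have t5 := norm_sub_le (ρ + ρ' + Ab * ρ' + H * G + H * ρ') (ρ * Ab)
    have t6 := norm_add_le (ρ + ρ' + Ab * ρ' + H * G + H * ρ' - ρ * Ab) (ρ * G)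
    have t7 := norm_add_le (ρ + ρ' + Ab * ρ' + H * G + H * ρ' - ρ * Ab + ρ * G) (ρ * ρ')
    have p4 : s ^ 4 ≤ s ^ 3 := pow_le_pow_of_le_one hs0 hs1 (by norm_num)
    have p5 : s ^ 5 ≤ s ^ 3 := pow_le_pow_of_le_one hs0 hs1 (by norm_num)
    have p6 : s ^ 6 ≤ s ^ 3 := pow_le_pow_of_le_one hs0 hs1 (by norm_num)
    nlinarith
  have u1 : ‖K - Kᵀ‖ ≤ 2 * s ^ 3 := (norm_sub_le _ _).trans (by rw [Matrix.frobenius_norm_transpose]; linarith)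
  have u2 : ‖R - Rᵀ‖ ≤ 3 * s ^ 3 := (norm_sub_le _ _).trans (by rw [Matrix.frobenius_norm_transpose]; linarith)
  exact (norm_add_le _ _).trans (by linarith)

end Matrices

end Summit.QuantumFields.BalabanUV.Beta.GAN24.DerivativeRateTransferJensenMassFreeExpTaylor
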